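import Summits.BirchSwinnertonDyer.Rank1Residual.Additive.CyclotomicTowerSignedLocal
import Literature.NumberTheory.EllipticCurves.Kobayashi2003.SignedSelmer
import HarnessLib

/-!
# A Kummer local condition over `L_w` LIFTS to `L'_w ⊆ L_w` when `E(L_w)[p^∞] = 0` — local
# injectivity up the tower for Kobayashi's Kummer conditions (cell `b2b-bsdres`, CLASS-CLOSURE
# lane, class O10 — x1b GEN 35, class lead; file 46 of the series: brick B2 of the GLOBAL count
# (C), part 3 — the local half of [K] Lemma 9.1 on Kummer descriptions)

HONEST FRAMING (cell `b2b-bsdres`, run/shared/lean/b2b/bsd-rank1-residual/, verbatim in every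
file): the goal of the cell is to DELETE the COMBINATION-SHAPED residual classes of the
Birch–Swinnerton-Dyer formula for ALL analytic-rank `≤ 1` elliptic curves over `ℚ` — "full BSD
formula for every rank `≤ 1` curve in class `C`" assembled STRICTLY from published theorems — so
that the rank-`≤ 1` remainder becomes exactly the CONSTRUCTION-SHAPED classes, which are TYPED
(missing-input `Prop`s), NOT attempted. This is not "finishing BSD". CLASS-CLOSURE lane: prove
what is provable now; shrink each hard class to its core with data; no claim beyond stated classes;
research routes on CONSTRUCTION-SHAPED X12 / O10; census / instrument output = EVIDENCE / conjecture
items, NEVER a Literature fact; `RESIDUAL-MAP.md` marks change only by signed lines. THIS FILE: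
ONE TOOL THEOREM over the tree's Kummer condition `localKummerOverOfEmb` (Kobayashi2003/SignedSelmer)
and cc-typer-6's `localFixedPointsOfEmb` — no definition, no named Literature fact, no Summits-side
fact `def … : Prop`, no `sorry`, axioms standard; nothing is booked; no label / mark / count /
sub-cell moves; (C1_η), (C2_η-GZ), (C3_η) stay typed as filed; O10 stays OPEN / CONSTRUCTION-SHAPED;
nothing about `BSD(W, p)` of any pair is claimed.

## What (brick B2 of the GLOBAL count (C), x1b GEN 34 `HSUM-UNCONDITIONAL-x1b.md` §3b)

`mem_localKummerOverOfEmb_of_resOfLe`: for subgroups `H ≤ H'` of `Γ_K` with `H` normal (fields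
`L' ⊆ L`), a `K`-embedding `ι : K̄ → K̄_E`, a subgroup `A ≤ E(L'_w)` of points fixed by
`Gal(K̄_E/L'_w)`, and NO non-zero `Gal(K̄_E/L_w)`-fixed `p`-power-torsion point in `E(K̄_E)`
(`E(L_w)[p^∞] = 0`): if the restriction to `H` of a class `y ∈ H¹(H', E[p^∞])` satisfies the Kummer
condition cut out by `A` (it is `[φ]` with `ι(φ(τ|)) = τQ − Q` on `Gal(K̄_E/L_w)`, `pᵏQ ∈ A`), then
`y` itself satisfies the Kummer condition cut out by `A` over `L'`. This is the step of the descent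
`A₀' ⊆ A₀` (file 47, `StrictSignedSelmerPreimageZero`) at the place above `p`: the level-`∞` strict
signed condition of a class coming from `K_n` is already the level-`n` condition, because
`H¹(K_{n,w}, E[p^∞]) → H¹(K_{∞,w}, E[p^∞])` loses nothing when `E(K_{∞,w})[p^∞] = 0` ([K] Lemma 9.1,
p. 25, is the global statement; Prop. 8.7, p. 16, supplies `E(k_∞)[p^∞] = 0` for Kobayashi's tower).
Proof (cocycles, no inflation–restriction needed): pick `ψ` representing `y`; `ψ|_H = φ + ∂m`,
`m ∈ E[p^∞]`; with `Q' = Q + ι(m)`, `ι(ψ(τ|)) = τQ' − Q'` on `Gal(K̄_E/L_w)` and `p^{k+a}Q' ∈ A`; the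
defect `c(τ) = ι(ψ(τ|)) − (τQ' − Q')` is a crossed homomorphism of `Gal(K̄_E/L'_w)` vanishing on the
normal subgroup `Gal(K̄_E/L_w)`, so its values are `Gal(K̄_E/L_w)`-fixed and `p`-power torsion, hence
zero.

References: [Kobayashi2003] S. Kobayashi, Invent. Math. 152 (2003), Def. 2.1 (p. 5), Prop. 8.7
(p. 16), Lemma 9.1 (p. 25); [SerreGaloisCohomology1997] J.-P. Serre, *Galois Cohomology*, I.§5.1
(crossed homomorphisms), I.§2.4; [GreenbergLNM1716] §2 p. 71 (Kummer sequence), §3 Lemma 3.1.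
-/

noncomputable section

open scoped Classical

open NumberField IsDedekindDomain

universe u

namespace Summit.BirchSwinnertonDyer.Rank1Residual.Additive

open Literature.NumberTheory.EllipticCurves Literature.NumberTheory.GaloisRepresentations
  Literature.NumberTheory.EllipticCurves.Kobayashi2003 ZpExtension

/-! ## §1 Local injectivity up the tower for Kummer conditions -/

section LocalInjective

variable {K : Type u} [Field K] (W : WeierstrassCurve K) (p : ℕ)
  {E : Type u} [Field E] [Algebra K E] (ι : AlgebraicClosure K →ₐ[K] AlgebraicClosure E)

/-- **A Kummer condition over `L` LIFTS to `L' ⊆ L` when `E(L_w)[p^∞] = 0`.** Let `H ≤ H' ≤ Γ_K`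
with `H` normal (`L' ⊆ L`), `A ≤ E(L'_w)` (points fixed by `Gal(K̄_E/L'_w)`), and assume that
`E(K̄_E)` has no non-zero `p`-power-torsion point fixed by `Gal(K̄_E/L_w)`. If `y ∈ H¹(H', E[p^∞])`
restricts into the Kummer condition cut out by `A` over `L` (`res y = [φ]`, `ι(φ(τ|)) = τQ − Q` on
`Gal(K̄_E/L_w)`, `pᵏQ ∈ A`), then `y` itself lies in the Kummer condition cut out by `A` over `L'`.
Proof: pick `ψ` representing `y`; `ψ|_H = φ + ∂m` with `m ∈ E[p^∞]`, so with `Q' = Q + ι(m)` one has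
`ι(ψ(τ|)) = τQ' − Q'` on `Gal(K̄_E/L_w)` and `p^{k+a}Q' ∈ A`; the map
`c(τ) = ι(ψ(τ|)) − (τQ' − Q')` is a crossed homomorphism of `Gal(K̄_E/L'_w)` vanishing on the normal
subgroup `Gal(K̄_E/L_w)`, so its values are `Gal(K̄_E/L_w)`-fixed; they are `p`-power torsion
(`ψ` is torsion-valued, `p^{k+a}Q'` is fixed by `Gal(K̄_E/L'_w)`); hence `c = 0`. This is the local
counterpart of [K] Lemma 9.1 (`H¹(K_n, E[p^∞]) → H¹(K_∞, E[p^∞])` injective when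
`E(K_∞)[p^∞] = 0`), on Kummer descriptions. [cite: Kobayashi2003, Lemma 9.1 (p. 25), Def. 2.1 (p. 5)]
[cite: SerreGaloisCohomology1997, I.§5.1] -/
theorem mem_localKummerOverOfEmb_of_resOfLe {H H' : Subgroup (Field.absoluteGaloisGroup K)}
    [hN : H.Normal] (h : H ≤ H') {A : AddSubgroup (localPoints W E)}
    (hA : A ≤ localFixedPointsOfEmb ι W H')
    (htors : ∀ P : localPoints W E, P ∈ localFixedPointsOfEmb ι W H →
      (∃ j : ℕ, p ^ j • P = 0) → P = 0)
    {y : W.subgroupH1 p H'} (hy : W.resOfLe p h y ∈ localKummerOverOfEmb W p H ι A) :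
    y ∈ localKummerOverOfEmb W p H' ι A := by
  obtain ⟨φ, Q, k, hφc, hQA, hφ⟩ := hy
  obtain ⟨ψ, rfl⟩ := oneCocycleClass_surjective _ y
  have hρ : ∀ (G : Subgroup (Field.absoluteGaloisGroup K)) (g : G) (v : W.geomPrimaryTorsion p),
      (discreteTopRep G (W.geomPrimaryTorsion p)).ρ g v = g • v := fun _ _ _ ↦ rfl
  -- `ψ|_H` and `φ` have the same class: `ψ|_H − φ = ∂m`
  have hres : oneCocycleClass _ (contOneCocycles.pullback (subgroupInclusion h)
      (resHomOfEquivariant (subgroupInclusion h) (AddMonoidHom.id (W.geomPrimaryTorsion p))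
        (fun _ _ ↦ rfl)) ψ) = oneCocycleClass _ φ := by
    rw [← map_oneCocycleClass]; exact hφc.symm
  have hdiff : oneCocycleClass _ (contOneCocycles.pullback (subgroupInclusion h)
      (resHomOfEquivariant (subgroupInclusion h) (AddMonoidHom.id (W.geomPrimaryTorsion p))
        (fun _ _ ↦ rfl)) ψ - φ) = 0 := by
    rw [oneCocycleClass_sub, hres, sub_self]
  obtain ⟨m, hm⟩ := (oneCocycleClass_eq_zero_iff _ _).mp hdiff
  -- values: `ψ(σ) = φ(σ) + (σ • m − m)` for `σ ∈ H`
  have hval : ∀ σ : H, ψ.1 ⟨(σ : Field.absoluteGaloisGroup K), h σ.2⟩ = φ.1 σ + (σ • m - m) := by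
    intro σ
    have e := hm σ
    rw [Submodule.coe_sub, ContinuousMap.sub_apply, sub_eq_iff_eq_add', hρ] at e
    exact e
  obtain ⟨a, ha⟩ := AddCommGroup.mem_primaryComponent.mp m.2
  set t : localPoints W E := pointsMapOfEmb W ι ((m : W.geomPrimaryTorsion p) : W.geomPoints) with ht
  have hta : p ^ a • t = 0 := by
    rw [ht, ← map_nsmul, ha, map_zero]
  -- the new Kummer datum `Q' = Q + t`, `k' = k + a`
  have hQ' : p ^ (k + a) • (Q + t) = p ^ a • (p ^ k • Q) := by
    rw [smul_add, add_comm k a, pow_add, mul_smul, mul_smul, smul_comm (p ^ a) (p ^ k) t, hta,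
      smul_zero, add_zero]
  have hQ'A : p ^ (k + a) • (Q + t) ∈ A := by
    rw [hQ']; exact AddSubgroup.nsmul_mem A hQA _
  refine ⟨ψ, Q + t, k + a, rfl, hQ'A, fun τ ↦ ?_⟩
  -- the Kummer identity on `H_E` for `(ψ, Q')`
  have hH : ∀ (σ : Field.absoluteGaloisGroup E) (hσ : σ ∈ localSubgroupOfEmb H ι),
      pointsMapOfEmb W ι ((ψ.1 (resGalSubgroupOfEmb H' ι ⟨σ, Subgroup.comap_mono h hσ⟩) :
        W.geomPrimaryTorsion p) : W.geomPoints) = σ • (Q + t) - (Q + t) := by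
    intro σ hσ
    have e : ψ.1 (resGalSubgroupOfEmb H' ι ⟨σ, Subgroup.comap_mono h hσ⟩) =
        φ.1 (resGalSubgroupOfEmb H ι ⟨σ, hσ⟩) + (resGalSubgroupOfEmb H ι ⟨σ, hσ⟩ • m - m) :=
      hval (resGalSubgroupOfEmb H ι ⟨σ, hσ⟩)
    have e2 : pointsMapOfEmb W ι ((φ.1 (resGalSubgroupOfEmb H ι ⟨σ, hσ⟩) : W.geomPrimaryTorsion p) :
        W.geomPoints) = σ • Q - Q := hφ ⟨σ, hσ⟩
    rw [e, AddMemClass.coe_add, map_add, e2, AddSubgroupClass.coe_sub, map_sub, Subgroup.smul_def,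
      primaryComponent.coe_smul, resGalSubgroupOfEmb_apply_coe, pointsMapOfEmb_smul, ← ht, smul_add]
    change σ • Q - Q + (σ • t - t) = σ • Q + σ • t - (Q + t)
    abel
  -- the defect `c(τ) = ι(ψ(τ|)) − (τQ' − Q')` on `H'_E`
  set c : localSubgroupOfEmb H' ι → localPoints W E := fun τ ↦
    pointsMapOfEmb W ι ((ψ.1 (resGalSubgroupOfEmb H' ι τ) : W.geomPrimaryTorsion p) : W.geomPoints) -
      ((τ : Field.absoluteGaloisGroup E) • (Q + t) - (Q + t)) with hc
  -- `c` is a crossed homomorphism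
  have hcocy : ∀ τ₁ τ₂ : localSubgroupOfEmb H' ι,
      c (τ₁ * τ₂) = c τ₁ + (τ₁ : Field.absoluteGaloisGroup E) • c τ₂ := by
    intro τ₁ τ₂
    have e := ψ.2 (resGalSubgroupOfEmb H' ι τ₁) (resGalSubgroupOfEmb H' ι τ₂)
    rw [← map_mul, hρ] at e
    simp only [hc]
    rw [e, AddMemClass.coe_add, map_add, Subgroup.smul_def, primaryComponent.coe_smul,
      resGalSubgroupOfEmb_apply_coe, pointsMapOfEmb_smul, Subgroup.coe_mul, mul_smul, smul_sub,
      smul_sub, smul_add]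
    abel
  -- `c` vanishes on `H_E`
  have hcH : ∀ (σ : Field.absoluteGaloisGroup E) (hσ : σ ∈ localSubgroupOfEmb H ι),
      c ⟨σ, Subgroup.comap_mono h hσ⟩ = 0 := by
    intro σ hσ
    simp only [hc]
    rw [sub_eq_zero]
    exact hH σ hσ
  -- hence its values are fixed by `H_E`
  have hcfix : c τ ∈ localFixedPointsOfEmb ι W H := by
    rw [mem_localFixedPointsOfEmb_iff]
    intro σ hσ
    have hστ : (τ : Field.absoluteGaloisGroup E)⁻¹ * σ * τ ∈ localSubgroupOfEmb H ι := by
      rw [mem_localSubgroupOfEmb_iff, map_mul, map_mul, map_inv]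
      exact hN.conj_mem' _ ((mem_localSubgroupOfEmb_iff H ι σ).mp hσ) _
    have e1 := hcocy ⟨σ, Subgroup.comap_mono h hσ⟩ τ
    have e2 := hcocy τ ⟨(τ : Field.absoluteGaloisGroup E)⁻¹ * σ * τ, Subgroup.comap_mono h hστ⟩
    have hprod : (⟨σ, Subgroup.comap_mono h hσ⟩ : localSubgroupOfEmb H' ι) * τ =
        τ * ⟨(τ : Field.absoluteGaloisGroup E)⁻¹ * σ * τ, Subgroup.comap_mono h hστ⟩ :=
      Subtype.ext (by simp [mul_assoc])
    rw [hprod, e2, hcH _ hστ, smul_zero, add_zero, hcH σ hσ, zero_add] at e1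
    exact e1.symm
  -- and `p`-power torsion
  have hctors : ∃ j : ℕ, p ^ j • c τ = 0 := by
    obtain ⟨b, hb⟩ := AddCommGroup.mem_primaryComponent.mp
      (ψ.1 (resGalSubgroupOfEmb H' ι τ) : W.geomPrimaryTorsion p).2
    have hX : p ^ b • pointsMapOfEmb W ι ((ψ.1 (resGalSubgroupOfEmb H' ι τ) : W.geomPrimaryTorsion p) :
        W.geomPoints) = 0 := by
      rw [← map_nsmul, hb, map_zero]
    have hfixA : p ^ (k + a) • (Q + t) ∈ localFixedPointsOfEmb ι W H' := hA hQ'A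
    have hY : p ^ (k + a) • ((τ : Field.absoluteGaloisGroup E) • (Q + t) - (Q + t)) = 0 := by
      rw [smul_sub, smul_comm, (mem_localFixedPointsOfEmb_iff ι W H' _).mp hfixA _ τ.2, sub_self]
    refine ⟨b + (k + a), ?_⟩
    simp only [hc]
    rw [smul_sub, pow_add, mul_smul, mul_smul, smul_comm (p ^ b) (p ^ (k + a)), hX, hY, smul_zero,
      smul_zero, sub_zero]
  have hczero : c τ = 0 := htors _ hcfix hctors
  simp only [hc, sub_eq_zero] at hczero
  exact hczero

end LocalInjective

end Summit.BirchSwinnertonDyer.Rank1Residual.Additive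

end
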